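import Summits.QuantumFields.YangMills.Theorems.LuscherReductionTwistedTraceScalingColourAverage
import Summits.QuantumFields.YangMills.Theorems.LuscherReductionTwistedTraceScalingRecordWeightConj
import HarnessLib

/-!
# The colour average of a Born–Oppenheimer product `φ(slowMean U)·Ω(relLinkVec U)` is `(colourAvg φ)(slowMean U)·Ω(relLinkVec U)` for colour-blind `Ω`
# (lane A of S-BASE, crux `TwistedTraceScaling` stmt-QuantumFields-20203, C4 INNER; design note `pub/ym-fleet/ym-luscher-20007-p1/COARSE-DESIGN.md` §24.4 (CA2))

The SLOW clause of the package is evaluated on BO functions `U ↦ φ(slowMean U)·Ω(relLinkVec U)` (slow amplitude × fibre profile in the polar-mean chart).  Under a global colour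
rotation `U ↦ gUg⁻¹` the slow variable conjugates (`polarMean_conj`) and the relative coordinate rotates (`relLinkVec_conj`, by the isometry `adL g`); so for a fibre profile `Ω`
that is blind to `adL` (e.g. any function of `‖P_s v‖`, `‖P_Γ v‖`: `starProjection_adL`, `norm_adLin`) the colour average (`…ColourAverage`) acts on the slow amplitude alone, and
there it is the ONE-SITE colour average — at `L = 1` every gauge transformation is constant, so `colourAvg (L := 1) φ` is a gauge-invariant one-site function:
* `slowMean_conj` — `slowMean (gUg⁻¹) = g·(slowMean U)·g⁻¹` (as a one-site gauge transformation);
* ★ `colourAvg_slowProduct` — `colourAvg (φ∘slowMean · Ω∘relLinkVec) U = (colourAvg φ)(slowMean U) · Ω(relLinkVec U)`;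
* `gaugeTransform_one_site_eq_const`, ★ `colourAvg_one_site_gaugeInvariant` — `colourAvg (L := 1) φ` is invariant under EVERY one-site gauge transformation.
With `tubeForm_colourAvg` / `tubeNormSq_colourAvg_le` this is the complete R32 bookkeeping: SLOW is a statement about `Ad`-invariant one-site amplitudes (input `innerNoIntruderOneOrbitAt_one`).
HONEST FRAMING: exact symmetry bookkeeping for a stub of a child of the CONDITIONAL reduction route R2b1; no spectral claim; C4 OPEN; not a gap, not Clay.
-/

set_option autoImplicit false

noncomputable section

open MeasureTheory Filter Topology Real
open scoped BigOperators
open Literature.MathematicalPhysics.QuantumFieldTheory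
open Literature.MathematicalPhysics.QuantumLattice

namespace Summit.QuantumFields.YangMills.Theorems.FemtoTransferGap.TwoLattice.Avg

open Summit.QuantumFields.YangMills.Theorems.FemtoTransferGap
open Summit.QuantumFields.YangMills.Theorems.FemtoTransferGap.TwoLattice.ConstTube
open Summit.QuantumFields.YangMills.Theorems.FemtoTransferGap.TwoLattice.Stiff (LinkSpace)

variable (L : ℕ) [NeZero L]

/-! ## §1 The slow variable conjugates -/

/-- `slowMean (gUg⁻¹) = g·(slowMean U)·g⁻¹`, i.e. the constant one-site gauge transformation of the slow variable. [folklore] -/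
theorem slowMean_conj (g : SU2) (U : GaugeConfig 3 L SU2) :
    slowMean L (gaugeTransform (fun _ : Site 3 L => g) U) = gaugeTransform (fun _ : Site 3 1 => g) (slowMean L U) := by
  funext e
  show polarMean L e.2 (gaugeTransform (fun _ : Site 3 L => g) U) = gaugeTransform (fun _ : Site 3 1 => g) (slowMean L U) e
  rw [polarMean_conj, gaugeTransform_const_apply']
  rfl

/-! ## §2 ★ The colour average of a slow × fibre product -/

/-- ★ **Colour average of a BO product**: for a fibre profile `Ω` blind to global colour rotations (`Ω (adL g v) = Ω v`),
`colourAvg (fun U => φ (slowMean U) * Ω (relLinkVec U)) U = colourAvg φ (slowMean U) * Ω (relLinkVec U)` (the right-hand `colourAvg` is the one-site one). [folklore] -/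
theorem colourAvg_slowProduct (φ : GaugeConfig 3 1 SU2 → ℝ) {Ω : LinkSpace L → ℝ} (hΩ : ∀ (g : SU2) (v : LinkSpace L), Ω (adL L g v) = Ω v)
    (U : GaugeConfig 3 L SU2) :
    colourAvg (fun V => φ (slowMean L V) * Ω (relLinkVec L V)) U = colourAvg (L := 1) φ (slowMean L U) * Ω (relLinkVec L U) := by
  unfold colourAvg
  rw [← integral_mul_const]
  refine integral_congr_ae (ae_of_all _ fun g => ?_)
  dsimp only
  rw [slowMean_conj, relLinkVec_conj, hΩ]

/-! ## §3 At one site every gauge transformation is constant -/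

/-- At `L = 1` a gauge transformation is the constant one at its unique site. [folklore] -/
theorem gaugeTransform_one_site_eq_const (g : Site 3 1 → SU2) (u : GaugeConfig 3 1 SU2) :
    gaugeTransform g u = gaugeTransform (fun _ : Site 3 1 => g 0) u := by
  have hg : g = fun _ => g 0 := funext fun x => congrArg g (Subsingleton.elim x 0)
  rw [← hg]

/-- ★ The one-site colour average is GAUGE INVARIANT (every one-site gauge transformation is a global colour rotation). [folklore] -/
theorem colourAvg_one_site_gaugeInvariant (φ : GaugeConfig 3 1 SU2 → ℝ) (g : Site 3 1 → SU2) (u : GaugeConfig 3 1 SU2) :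
    colourAvg (L := 1) φ (gaugeTransform g u) = colourAvg (L := 1) φ u := by
  rw [gaugeTransform_one_site_eq_const, colourAvg_conj]

/-- The one-site colour average of a function supported in `{orbitDist < δ}` is supported there too (`orbitDist` is gauge invariant). [folklore] -/
theorem colourAvg_one_site_support {φ : GaugeConfig 3 1 SU2 → ℝ} {δ : ℝ} (hφ : ∀ u, φ u ≠ 0 → orbitDist u < δ) {u : GaugeConfig 3 1 SU2}
    (hu : colourAvg (L := 1) φ u ≠ 0) : orbitDist u < δ := by
  by_contra hlt
  apply hu
  refine colourAvg_eq_zero_of_support (S := {w : GaugeConfig 3 1 SU2 | orbitDist w < δ}) (fun c w => ?_) (fun w hw => ?_) hlt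
  · simp only [Set.mem_setOf_eq, orbitDist_gaugeTransform]
  · by_contra h; exact hw (hφ w h)

end Summit.QuantumFields.YangMills.Theorems.FemtoTransferGap.TwoLattice.Avg

end
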